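import Literature.AlgebraicGeometry.HodgeTheory.AlgebraicClassesPullbackHolds
import Literature.AlgebraicGeometry.HodgeTheory.ComplexGysinCorrespondence
import Literature.AlgebraicGeometry.HodgeTheory.ComplexGysinOrientation
import Literature.AlgebraicGeometry.HodgeTheory.ComplexOrientationFamily
import Literature.AlgebraicGeometry.HodgeTheory.CorrespondenceComposition
import Literature.AlgebraicGeometry.HodgeTheory.CorrespondenceCupProductIdentities
import Literature.AlgebraicGeometry.HodgeTheory.GysinBaseChange
import Literature.AlgebraicGeometry.HodgeTheory.MotivatedClassesProofs
import Literature.AlgebraicTopology.SingularHomology.GysinMapOrientationChange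
import HarnessLib

/-!
# Algebraic correspondences on the complex cohomology of smooth projective complex varieties form a `ℂ`-linear
# category: the algebra of the actions `γ_* = pr_{1*}(pr_2^*(·) ∪ γ)` (composition, Lefschetz twists, linear
# combinations, powers) and the closure properties of the predicate `IsAlgebraicCorrespondence`

Fulton, *Intersection Theory*, §16.1 (Def. 16.1.1–2, Prop. 16.1.1): correspondences compose by
`γ'' = p₁₃_*(p₁₂^* γ · p₂₃^* γ')`, and `(γ' ∘ γ)_* = γ'_* ∘ γ_*`; Kleiman 1968 §1.3 / André 1996 §2.1: the algebraic
correspondences are closed under composition and linear combinations, so that they form the morphisms of a `ℚ`- (here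
`ℂ`-)linear category.  This file proves these statements for the tree's CONSTRUCTED action
`corrAction μ hW hX hab γ : Hᵃ(X(ℂ); ℂ) → Hᵇ(W(ℂ); ℂ)` of a class `γ ∈ H^{2e}((W ⊗ X)(ℂ); ℂ)`
(`HodgeTheory/ComplexGysinCorrespondence`, any orientation family `μ`) and for the tree's predicate
`IsAlgebraicCorrespondence m n W X T` (`HodgeTheory/MotivatedClasses`, André 1996 §2.1: "`T` is induced by an algebraic
class on `W × X` for some Poincaré-duality orientations"), on arbitrary smooth projective complex varieties.

Part 1 (namespace `AlgebraicCorrespondence`, the algebra of actions; everything stated as "there is an ALGEBRAIC class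
whose action is …"):
* §0 degree bookkeeping (`complexGysin_cupProduct_congr`);
* §1 **composition** `corrAction_comp`: `[γ]_* ∘ [γ']_* = [γ'']_*` with `γ'' = c • p₁₃_*(p₁₂^*γ ∪ p₂₃^*γ')` ALGEBRAIC —
  the tree's `corr_comp_of_baseChange` (Fulton Prop. 16.1.1) with its two hypotheses supplied: Gysin base change
  (`gysin_baseChange`, `HodgeTheory/GysinBaseChange`) and the multiplicativity of algebraic classes
  (`Voisin2003_cupProduct_algebraicClasses_holds'`, `HodgeTheory/AlgebraicClassesPullbackHolds`), fed to
  `corrCompClass_mem_algebraicClasses` (Buskin 2019 Lemma 6.3);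
* §2 **Lefschetz twists** `corrAction_comp_lefschetzOperator` / `corrAction_comp_lefschetzPow`:
  `[γ]_* ∘ Lʳ_η = [γ ∪ pr_2^* ηʳ]_*` for an algebraic `η ∈ N¹ H²(X(ℂ))`;
* §3 **linear combinations** `corrAction_sum_smul`; §4 **powers** `exists_corrAction_eq_pow_comp`,
  `exists_corrAction_eq_sum_pow_comp`: for algebraic endo-correspondences `w = [γ_w]_*` of `Hᵇ(X(ℂ))` and
  `F = [γ_F]_* : Hᵃ(Y(ℂ)) → Hᵇ(X(ℂ))`, every `wᵏ ∘ F` (and every `Σ cₖ wᵏ ∘ F`) is `[γ_k]_*` with `γ_k` algebraic.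

Part 2 (the predicate):
* §1 NORMALISATION: every witness can be moved to the complex orientations —
  `T = corrAction complexOrientationFamily hW hX hab γ` with `γ` algebraic (`IsAlgebraicCorrespondence.exists_eq_corrAction`;
  two orientations of the closed connected manifold `W(ℂ)`, resp. `(W ⊗ X)(ℂ)`, differ by a unit, Hatcher Thm. 3.26, and
  the Gysin homomorphism changes by the quotient of the units, Fulton *Young Tableaux* App. B (5), the tree's
  `gysinMap_eq_smul_of_fundamentalClass_eq`); conversely `isAlgebraicCorrespondence_corrAction_complex`; the degree
  bound `IsAlgebraicCorrespondence.le_two_mul`;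
* §2 closed under COMPOSITION (`IsAlgebraicCorrespondence.comp`, by Part 1 `corrAction_comp`) and under precomposition
  with Lefschetz operators of algebraic classes (`IsAlgebraicCorrespondence.comp_lefschetzPow`);
* §3 closed under SUMS and SCALARS (`IsAlgebraicCorrespondence.add`, `.smul`, `.neg`, `.sub`, `.sum`), and contains `0`
  (`isAlgebraicCorrespondence_zero`).

Theorems only: no definition, no named fact.  The dot-lemmas live in the namespace
`Literature.AlgebraicGeometry.HodgeTheory.AlgebraicCorrespondence` (so `IsAlgebraicCorrespondence.comp` here is
`…HodgeTheory.AlgebraicCorrespondence.IsAlgebraicCorrespondence.comp`; users `open … (IsAlgebraicCorrespondence.comp …)`).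

Provenance: Literature home (namespace `Literature.AlgebraicGeometry.HodgeTheory.AlgebraicCorrespondence`) of the
Summits-side `HodgeConjecture/Theorems/Ring2AbelianAllAndreLiebermanCorrespondenceAlgebra` (Part 1) and
`HodgeConjecture/Theorems/Ring2AbelianAllAndreCorrespondenceCategory` (Part 2), whose imports are `Literature/`, Mathlib
and the Summits twin of `Voisin2003_cupProduct_algebraicClasses_holds'`; re-homed so that Arapura's Lemma 4.2
(`HodgeTheory/DominatedByPowersHodgeConjectureHolds`) can be proved Literature-side. Lane `lit-hodgefound`, seat p20.

## References
* [Fulton1998] W. Fulton, *Intersection Theory*, 2nd ed. (1998), §16.1 Def. 16.1.1–2, Prop. 16.1.1, Ex. 16.1.1; Prop. 1.7.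
* [Kleiman1968AlgebraicCycles] S. Kleiman, *Algebraic cycles and the Weil conjectures* (1968), §1.3, App. to §2 2A11.
* [Andre1996Motifs] Y. André, *Pour une théorie inconditionnelle des motifs*, Publ. Math. IHÉS 83 (1996), §2.1 (p. 14).
* [Buskin2019] N. Buskin, *Every rational Hodge isometry between two K3 surfaces is algebraic*, J. reine angew. Math. 755
  (2019), Lemma 6.3.
* [VoisinHodgeII2003] C. Voisin, *Hodge Theory and Complex Algebraic Geometry II* (2003), §9.2.4 Prop. 9.20–9.21, proof of
  Thm. 10.17 (10.7).
* [FultonYoungTableaux1997] W. Fulton, *Young Tableaux* (1997), App. B §B.1 (3), (5), (6).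
* [HatcherAT2002] A. Hatcher, *Algebraic Topology* (2002), §3.2 Prop. 3.10, Thm. 3.11, §3.3 Thm. 3.26.
-/

noncomputable section

namespace Literature.AlgebraicGeometry.HodgeTheory.AlgebraicCorrespondence

/-! ## Part 1: The algebra of correspondence actions — composition, Lefschetz twists, linear combinations, powers -/

section Part1

open _root_.CategoryTheory _root_.AlgebraicGeometry MonoidalCategory CartesianMonoidalCategory
open Literature.AlgebraicGeometry Literature.AlgebraicGeometry.Motives
open Literature.AlgebraicGeometry.HodgeTheory
open Literature.AlgebraicTopology.SingularHomology (singularCohomology cupProduct cupProduct_assoc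
  cupProduct_gradedComm_holds)
open Literature.Geometry.Kaehler (lefschetzOperator lefschetzPow lefschetzOperator_apply lefschetzPow_zero
  lefschetzPow_succ)

variable (μ : OrientationFamily) {l m n : ℕ} {W X Y Z : SchemeOver ℂ}

/-! ## §0 Degree bookkeeping -/

/-- The Gysin image of a cup product does not depend on the spelling of its degree. [cite: Fulton1998, §16.1 Def. 16.1.1–2 and Prop. 16.1.1] -/
theorem complexGysin_cupProduct_congr {T : SchemeOver ℂ} (hT : IsSmoothProjective l T) (hW : IsSmoothProjective m W)
    (f : T ⟶ W) {p q k₁ k₂ b : ℕ} (h₁ : p + q = k₁) (h₂ : p + q = k₂) (d₁ : k₁ + 2 * m = b + 2 * l)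
    (d₂ : k₂ + 2 * m = b + 2 * l) (y : complexBetti T p) (z : complexBetti T q) :
    complexGysin μ hT hW f d₁ (cupProduct h₁ y z) = complexGysin μ hT hW f d₂ (cupProduct h₂ y z) := by
  subst h₁; subst h₂; rfl

/-! ## §1 Composition of algebraic correspondences is an algebraic correspondence -/

/-- **Composition.** For smooth projective `X, Y, Z` (dimensions `l, m, n`) and ALGEBRAIC classes
`γ ∈ Nᵉ H^{2e}((X ⊗ Y)(ℂ))`, `γ' ∈ Nᵉ' H^{2e'}((Y ⊗ Z)(ℂ))` with `e + e' = e'' + m`, there is an ALGEBRAIC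
`γ'' ∈ Nᵉ'' H^{2e''}((X ⊗ Z)(ℂ))` with `[γ'']_* = [γ]_* ∘ [γ']_*` on `Hᵃ(Z(ℂ); ℂ)` — namely
`γ'' = c • p₁₃_*(p₁₂^* γ ∪ p₂₃^* γ')` (Fulton Def. 16.1.1 / Prop. 16.1.1: the tree's `corr_comp_of_baseChange`, whose
base-change hypothesis is the tree's theorem `gysin_baseChange` and whose moving-lemma hypothesis is the tree's theorem
`Voisin2003_cupProduct_algebraicClasses_holds'`, through `corrCompClass_mem_algebraicClasses`, Buskin Lemma 6.3).
[cite: Fulton1998, §16.1 Def. 16.1.1 and Prop. 16.1.1] [cite: Buskin2019, Lemma 6.3] [cite: VoisinHodgeII2003, §9.2.4 Prop. 9.20] -/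
theorem corrAction_comp (hX : IsSmoothProjective l X) (hY : IsSmoothProjective m Y) (hZ : IsSmoothProjective n Z)
    {e e' e'' a a₁ a₂ : ℕ} (he : e + e' = e'' + m) (h₁ : a + 2 * e' = a₁ + 2 * n) (h₂ : a₁ + 2 * e = a₂ + 2 * m)
    (h₃ : a + 2 * e'' = a₂ + 2 * n)
    {γ : complexBetti (X ⊗ Y) (2 * e)} (hγ : γ ∈ algebraicClasses (X ⊗ Y) e)
    {γ' : complexBetti (Y ⊗ Z) (2 * e')} (hγ' : γ' ∈ algebraicClasses (Y ⊗ Z) e') :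
    ∃ γ'' ∈ algebraicClasses (X ⊗ Z) e'',
      corrAction μ hX hZ h₃ γ'' = corrAction μ hX hY h₂ γ ∘ₗ corrAction μ hY hZ h₁ γ' := by
  have hμ : μ.HasPoincareDuality := OrientationFamily.hasPoincareDuality μ
  obtain ⟨c, hc⟩ := gysin_baseChange μ hX hY hZ (k := a + 2 * e') (k₁ := a₁)
    (show a + 2 * e' + 2 * m = a₁ + 2 * (m + n) by omega)
  have hT := hX.tensor_holds (hY.tensor_holds hZ)
  refine ⟨c • complexGysin μ hT (hX.tensor_holds hZ) (X ◁ snd Y Z)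
      (show 2 * (e + e') + 2 * (l + n) = 2 * e'' + 2 * (l + (m + n)) by omega)
      (cupProduct ((Nat.mul_add 2 e e').symm : 2 * e + 2 * e' = 2 * (e + e'))
        (complexBetti.map (X ◁ fst Y Z) (2 * e) γ) (complexBetti.map (snd X (Y ⊗ Z)) (2 * e') γ')),
    Submodule.smul_mem _ _ (corrCompClass_mem_algebraicClasses hμ hX hY hZ he
      (fun a ha b hb ↦ Voisin2003_cupProduct_algebraicClasses_holds' hT
        ha hb) hγ hγ'), ?_⟩
  refine LinearMap.ext fun y ↦ ?_
  rw [LinearMap.comp_apply, corrAction_apply, corrAction_apply, corrAction_apply]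
  exact corr_comp_of_baseChange hμ hX hY hZ h₁ h₂ (show 2 * e + 2 * e' = 2 * e'' + 2 * m by omega)
    ((Nat.mul_add 2 e e').symm) γ γ' c hc y

/-! ## §2 Lefschetz twists: `[γ]_* ∘ L_η = [pr_2^* η ∪ γ]_*` -/

/-- **One Lefschetz twist.** For `η ∈ N¹ H²(X(ℂ))` algebraic and `γ ∈ Nᵉ H^{2e}((W ⊗ X)(ℂ))` algebraic, the composite of
`[γ]_* : H^{a₂}(X(ℂ)) → Hᵇ(W(ℂ))` with the Lefschetz operator `L_η : H^{a₁}(X(ℂ)) → H^{a₂}(X(ℂ))` (`2 + a₁ = a₂`) is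
`[pr_X^* η ∪ γ]_*`, an algebraic correspondence of codimension `e + 1`:
`pr_{W*}(pr_X^*(η ∪ x) ∪ γ) = pr_{W*}(pr_X^* x ∪ (pr_X^* η ∪ γ))` (Hatcher 3.10–3.11; Voisin II Prop. 9.20 for the
algebraicity of the cup product, the tree's theorem `Voisin2003_cupProduct_algebraicClasses_holds'`).
[cite: VoisinHodgeII2003, §9.2.4 Prop. 9.20 and proof of Thm. 10.17 (10.7)] [cite: HatcherAT2002, §3.2 Prop. 3.10 and Thm. 3.11] -/
theorem corrAction_comp_lefschetzOperator (hW : IsSmoothProjective m W) (hX : IsSmoothProjective n X)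
    {η : complexBetti X 2} (hη : η ∈ algebraicClasses X 1) {e a₁ a₂ b : ℕ} (h12 : 2 + a₁ = a₂)
    (hab : a₂ + 2 * e = b + 2 * n) (hab₁ : a₁ + 2 * (e + 1) = b + 2 * n)
    {γ : complexBetti (W ⊗ X) (2 * e)} (hγ : γ ∈ algebraicClasses (W ⊗ X) e) :
    ∃ γ₁ ∈ algebraicClasses (W ⊗ X) (e + 1), ∀ x : complexBetti X a₁,
      corrAction μ hW hX hab₁ γ₁ x = corrAction μ hW hX hab γ (lefschetzOperator η h12 x) := by
  have hWX := hW.tensor_holds hX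
  -- `γ₁ = pr_X^* η ∪ γ`
  have hηWX : complexBetti.map (snd W X) 2 η ∈ algebraicClasses (W ⊗ X) 1 :=
    map_snd_mem_supportedClasses hW hX (a := 2 * 1) hη
  have hγ₁ : cupProduct (show 2 * 1 + 2 * e = 2 * (e + 1) by omega) (complexBetti.map (snd W X) 2 η) γ ∈
      algebraicClasses (W ⊗ X) (e + 1) := by
    have h := Voisin2003_cupProduct_algebraicClasses_holds' hWX hηWX hγ
    exact (cupProduct_mem_supportedClasses_congr (two_mul_add_two_mul 1 e) (show 2 * 1 + 2 * e = 2 * (e + 1) by omega)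
      (Nat.add_comm 1 e) _ _).1 h
  refine ⟨_, hγ₁, fun x ↦ ?_⟩
  rw [corrAction_apply, corrAction_apply, lefschetzOperator_apply, complexBetti.map_cupProduct]
  -- `pr_X^* η ∪ pr_X^* x = pr_X^* x ∪ pr_X^* η` (degree `2` is even)
  rw [cupProduct_gradedComm_holds ℂ _ h12 (show a₁ + 2 = a₂ by omega) (complexBetti.map (snd W X) 2 η)
    (complexBetti.map (snd W X) a₁ x)]
  have heven : ((-1 : ℂ) ^ (2 * a₁)) = 1 := by rw [pow_mul, neg_one_sq, one_pow]
  rw [heven, one_smul]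
  -- reassociate: `(pr_X^* x ∪ pr_X^* η) ∪ γ = pr_X^* x ∪ (pr_X^* η ∪ γ)`, then re-spell the degree of the Gysin source
  rw [cupProduct_assoc (show a₁ + 2 = a₂ by omega) (show 2 * 1 + 2 * e = 2 * (e + 1) by omega) rfl
    (show a₁ + 2 * (e + 1) = a₂ + 2 * e by omega)]
  exact complexGysin_cupProduct_congr μ hWX hW (fst W X) rfl _ _ _ _ _

/-- **Iterated Lefschetz twist.** For `η ∈ N¹ H²(X(ℂ))` and `γ ∈ Nᵉ H^{2e}((W ⊗ X)(ℂ))` algebraic and every `r`: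
the composite of `[γ]_* : H^{a + 2r}(X(ℂ)) → Hᵇ(W(ℂ))` with `Lʳ_η : Hᵃ(X(ℂ)) → H^{a+2r}(X(ℂ))` is `[γ']_*` for an algebraic
`γ'` of codimension `e'`, `e + r = e'` (namely `pr_X^* ηʳ ∪ γ`). [cite: VoisinHodgeII2003, §9.2.4 Prop. 9.20 and proof of Thm. 10.17 (10.7)] -/
theorem corrAction_comp_lefschetzPow (hW : IsSmoothProjective m W) (hX : IsSmoothProjective n X)
    {η : complexBetti X 2} (hη : η ∈ algebraicClasses X 1) (a : ℕ) :
    ∀ (r : ℕ) {e e' b : ℕ} (_he : e + r = e') (hab : a + 2 * r + 2 * e = b + 2 * n) (hab' : a + 2 * e' = b + 2 * n)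
      {γ : complexBetti (W ⊗ X) (2 * e)} (_hγ : γ ∈ algebraicClasses (W ⊗ X) e),
      ∃ γ' ∈ algebraicClasses (W ⊗ X) e', ∀ x : complexBetti X a,
        corrAction μ hW hX hab' γ' x = corrAction μ hW hX hab γ (lefschetzPow η r a x)
  | 0, e, e', b, he, hab, hab', γ, hγ => by
    obtain rfl : e = e' := by omega
    exact ⟨γ, hγ, fun x ↦ by rw [lefschetzPow_zero, LinearMap.id_apply]⟩
  | r + 1, e, e', b, he, hab, hab', γ, hγ => by
    -- peel off the outermost `L`: `[γ]_* ∘ L^{r+1} = ([γ]_* ∘ L) ∘ Lʳ`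
    obtain ⟨γ₁, hγ₁, h₁⟩ := corrAction_comp_lefschetzOperator μ hW hX hη
      (show 2 + (a + 2 * r) = a + 2 * (r + 1) by omega) hab (show a + 2 * r + 2 * (e + 1) = b + 2 * n by omega) hγ
    obtain ⟨γ', hγ', h'⟩ := corrAction_comp_lefschetzPow hW hX hη a r (show e + 1 + r = e' by omega)
      (show a + 2 * r + 2 * (e + 1) = b + 2 * n by omega) hab' hγ₁
    refine ⟨γ', hγ', fun x ↦ ?_⟩
    rw [h', lefschetzPow_succ, LinearMap.comp_apply, h₁]

/-! ## §3 Linear combinations -/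

/-- **Linear combinations of correspondence actions with a common degree are correspondence actions of the linear
combination of the classes** (`corrAction` is linear in the class), and the combination of algebraic classes is
algebraic. [cite: VoisinHodgeII2003, proof of Thm. 10.17 (10.7)] -/
theorem corrAction_sum_smul (hW : IsSmoothProjective m W) (hX : IsSmoothProjective n X) {e a b : ℕ}
    (hab : a + 2 * e = b + 2 * n) {ι : Type*} (s : Finset ι) (d : ι → ℂ)
    (γ : ι → complexBetti (W ⊗ X) (2 * e)) (hγ : ∀ k ∈ s, γ k ∈ algebraicClasses (W ⊗ X) e) :
    (∑ k ∈ s, d k • γ k) ∈ algebraicClasses (W ⊗ X) e ∧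
      corrAction μ hW hX hab (∑ k ∈ s, d k • γ k) = ∑ k ∈ s, d k • corrAction μ hW hX hab (γ k) := by
  refine ⟨Submodule.sum_mem _ fun k hk ↦ Submodule.smul_mem _ _ (hγ k hk), ?_⟩
  rw [map_sum]
  exact Finset.sum_congr rfl fun k _ ↦ by rw [map_smul]

/-! ## §4 Powers of an algebraic endo-correspondence composed with an algebraic correspondence -/

/-- **`wᵏ ∘ F` is an algebraic correspondence.** For smooth projective `X`, `Y` (dimensions `m`, `n`), an algebraic
endo-correspondence `w = [γ_w]_*` of `Hᵇ(X(ℂ); ℂ)` (`γ_w ∈ Nᵐ H^{2m}((X ⊗ X)(ℂ))`) and an algebraic correspondence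
`F = [γ_F]_* : Hᵃ(Y(ℂ)) → Hᵇ(X(ℂ))` (`γ_F ∈ Nᵉ`), every `wᵏ ∘ F` is `[γ_k]_*` with `γ_k ∈ Nᵉ H^{2e}((X ⊗ Y)(ℂ))` algebraic
(induction on `k`, §1). [cite: Fulton1998, §16.1 Prop. 16.1.1] [cite: Kleiman1968AlgebraicCycles, §1.3 and Appendix to §2, 2A11] -/
theorem exists_corrAction_eq_pow_comp (hX : IsSmoothProjective m X) (hY : IsSmoothProjective n Y) {e a b : ℕ}
    (habF : a + 2 * e = b + 2 * n) (habw : b + 2 * m = b + 2 * m)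
    {γF : complexBetti (X ⊗ Y) (2 * e)} (hγF : γF ∈ algebraicClasses (X ⊗ Y) e)
    {γw : complexBetti (X ⊗ X) (2 * m)} (hγw : γw ∈ algebraicClasses (X ⊗ X) m) :
    ∀ k : ℕ, ∃ γk ∈ algebraicClasses (X ⊗ Y) e,
      corrAction μ hX hY habF γk = ((corrAction μ hX hX habw γw) ^ k) ∘ₗ corrAction μ hX hY habF γF
  | 0 => ⟨γF, hγF, by rw [pow_zero, Module.End.one_eq_id, LinearMap.id_comp]⟩
  | k + 1 => by
    obtain ⟨γk, hγk, hk⟩ := exists_corrAction_eq_pow_comp hX hY habF habw hγF hγw k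
    obtain ⟨γ'', hγ'', h''⟩ := corrAction_comp μ hX hX hY (e := m) (e' := e) (e'' := e) (by omega) habF habw habF
      hγw hγk
    refine ⟨γ'', hγ'', ?_⟩
    rw [h'', hk, pow_succ', Module.End.mul_eq_comp, LinearMap.comp_assoc]

/-- **Polynomials in an algebraic endo-correspondence, composed with an algebraic correspondence, are algebraic
correspondences**: with `w`, `F` as above and any finitely supported coefficients `d`, `(Σ_k d_k wᵏ) ∘ F = [γ]_*` for an
algebraic `γ ∈ Nᵉ H^{2e}((X ⊗ Y)(ℂ))`. [cite: Kleiman1968AlgebraicCycles, Appendix to §2, 2A11] -/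
theorem exists_corrAction_eq_sum_pow_comp (hX : IsSmoothProjective m X) (hY : IsSmoothProjective n Y) {e a b : ℕ}
    (habF : a + 2 * e = b + 2 * n) (habw : b + 2 * m = b + 2 * m)
    {γF : complexBetti (X ⊗ Y) (2 * e)} (hγF : γF ∈ algebraicClasses (X ⊗ Y) e)
    {γw : complexBetti (X ⊗ X) (2 * m)} (hγw : γw ∈ algebraicClasses (X ⊗ X) m) (s : Finset ℕ) (d : ℕ → ℂ) :
    ∃ γ ∈ algebraicClasses (X ⊗ Y) e,
      corrAction μ hX hY habF γ =
        (∑ k ∈ s, d k • (corrAction μ hX hX habw γw) ^ k) ∘ₗ corrAction μ hX hY habF γF := by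
  classical
  choose γk hγk hk using exists_corrAction_eq_pow_comp μ hX hY habF habw hγF hγw
  obtain ⟨hmem, hsum⟩ := corrAction_sum_smul μ hX hY habF s d γk (fun k _ ↦ hγk k)
  refine ⟨_, hmem, ?_⟩
  rw [hsum]
  refine LinearMap.ext fun y ↦ ?_
  simp only [LinearMap.sum_apply, LinearMap.comp_apply, LinearMap.smul_apply, hk]

end Part1

/-! ## Part 2: The predicate `IsAlgebraicCorrespondence` — normalisation to the complex orientations, composition, sums and scalars -/

section Part2

open _root_.CategoryTheory _root_.AlgebraicGeometry MonoidalCategory CartesianMonoidalCategory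
open Literature.AlgebraicGeometry Literature.AlgebraicGeometry.Motives
open Literature.AlgebraicGeometry.HodgeTheory
open Literature.AlgebraicTopology.SingularHomology (singularCohomology cupProduct gysinMap HomologicalOrientation
  gysinMap_eq_smul_of_fundamentalClass_eq)
open Literature.Geometry.Kaehler (lefschetzPow)

variable {l m n : ℕ} {W X Y Z : SchemeOver ℂ}

/-! ## §1 Normalisation to the complex orientations -/

/-- **Every algebraic correspondence is `[γ]_*` for the COMPLEX orientations.** If `T : Hᵃ(X(ℂ)) → Hᵇ(W(ℂ))` is induced by
an algebraic class for some Poincaré-duality orientations `μ` of `(W ⊗ X)(ℂ)` and `ν` of `W(ℂ)`, then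
`T = corrAction complexOrientationFamily hW hX hab γ` for an algebraic `γ` of the same codimension: `[M]_μ = u_μ [M]`,
`[W]_ν = u_ν [W]` with units `u` (closed connected manifolds), so `pr_{W*}^{μ,ν} = (u_ν⁻¹ u_μ) pr_{W*}` and the scalar is
absorbed into `γ`. [cite: HatcherAT2002, §3.3 Thm. 3.26] [cite: FultonYoungTableaux1997, Appendix B §B.1 (5)]
[cite: Andre1996Motifs, §2.1 remark following Déf. 1 (p. 14)] -/
theorem IsAlgebraicCorrespondence.exists_eq_corrAction (hW : IsSmoothProjective m W) (hX : IsSmoothProjective n X)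
    {a b : ℕ} {T : complexBetti X a →ₗ[ℂ] complexBetti W b} (h : IsAlgebraicCorrespondence m n W X T) :
    ∃ (e : ℕ) (hab : a + 2 * e = b + 2 * n) (γ : complexBetti (W ⊗ X) (2 * e)),
      γ ∈ algebraicClasses (W ⊗ X) e ∧ T = corrAction complexOrientationFamily hW hX hab γ := by
  obtain ⟨μ, ν, hμ, hν, e, q, hab, hq, γ, hγ, hT⟩ := h
  have hWX : IsSmoothProjective (m + n) (W ⊗ X) := hW.tensor_holds hX
  -- the two pairs of orientations differ by units
  obtain ⟨uM, huM⟩ : ∃ u : ℂˣ, μ.fundamentalClass = (u : ℂ) • (complexOrientationFamily hWX).fundamentalClass := by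
    letI := hWX.chartedSpace
    haveI := ComplexPoints.compactSpace_of_isSmoothProjective hWX
    haveI := ComplexPoints.t2Space_of_isSmoothProjective hWX
    haveI := connectedSpace_complexPoints hWX
    obtain ⟨u, hu, -⟩ := (complexOrientationFamily hWX).exists_unit_fundamentalClass_eq_smul μ
    exact ⟨u, hu⟩
  obtain ⟨uW, huW⟩ : ∃ u : ℂˣ, ν.fundamentalClass = (u : ℂ) • (complexOrientationFamily hW).fundamentalClass := by
    letI := hW.chartedSpace
    haveI := ComplexPoints.compactSpace_of_isSmoothProjective hW
    haveI := ComplexPoints.t2Space_of_isSmoothProjective hW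
    haveI := connectedSpace_complexPoints hW
    obtain ⟨u, hu, -⟩ := (complexOrientationFamily hW).exists_unit_fundamentalClass_eq_smul ν
    exact ⟨u, hu⟩
  set c : ℂ := (uW : ℂ)⁻¹ * (uM : ℂ) with hc
  have hgysin : gysinMap μ ν (AlgPoints.mapContinuous (L := ℂ) (fst W X))
        (show a + 2 * e + q = 2 * (m + n) by omega) hq =
      c • gysinMap (complexOrientationFamily hWX) (complexOrientationFamily hW)
        (AlgPoints.mapContinuous (L := ℂ) (fst W X)) (show a + 2 * e + q = 2 * (m + n) by omega) hq :=
    gysinMap_eq_smul_of_fundamentalClass_eq (hasPoincareDuality_complexOrientationFamily hW) hν huM huW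
      (by rw [hc, ← mul_assoc, mul_inv_cancel₀ uW.ne_zero, one_mul]) _ _ _
  refine ⟨e, hab, c • γ, Submodule.smul_mem _ _ hγ, ?_⟩
  rw [← hT, map_smul, corrAction_eq_corrClassAction complexOrientationFamily hW hX hab hq]
  refine LinearMap.ext fun x ↦ ?_
  rw [LinearMap.smul_apply, corrClassAction_apply, corrClassAction_apply, hgysin, LinearMap.smul_apply]

/-- Converse packaging: `corrAction complexOrientationFamily hW hX hab γ` with `γ` algebraic IS an algebraic correspondence
(the tree's `isAlgebraicCorrespondence_corrAction`, with the auxiliary degree `q = 2m − b` supplied; `b ≤ 2m` is automatic when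
`Hᵇ(W(ℂ)) ≠ 0`, and assumed here). [cite: Andre1996Motifs, §2.1 remark following Déf. 1 (p. 14)] -/
theorem isAlgebraicCorrespondence_corrAction_complex (hW : IsSmoothProjective m W) (hX : IsSmoothProjective n X)
    {e a b : ℕ} (hab : a + 2 * e = b + 2 * n) (hb : b ≤ 2 * m) {γ : complexBetti (W ⊗ X) (2 * e)}
    (hγ : γ ∈ algebraicClasses (W ⊗ X) e) :
    IsAlgebraicCorrespondence m n W X (corrAction complexOrientationFamily hW hX hab γ) :=
  isAlgebraicCorrespondence_corrAction complexOrientationFamily hasPoincareDuality_complexOrientationFamily hW hX hab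
    (show b + (2 * m - b) = 2 * m by omega) hγ

/-- The auxiliary degree inequality `b ≤ 2 dim W` holds for every algebraic correspondence into `Hᵇ(W(ℂ))` (it is part of the
witness). [cite: Fulton1998, §16.1 Def. 16.1.1–2 and Prop. 16.1.1] -/
theorem IsAlgebraicCorrespondence.le_two_mul {a b : ℕ} {T : complexBetti X a →ₗ[ℂ] complexBetti W b}
    (h : IsAlgebraicCorrespondence m n W X T) : b ≤ 2 * m := by
  obtain ⟨_, _, _, _, _, q, _, hq, _⟩ := h
  omega

/-! ## §2 Composition -/

/-- **Composition of algebraic correspondences is an algebraic correspondence** (Fulton Def. 16.1.1 / Prop. 16.1.1 on the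
real carriers): for smooth projective `X, Y, Z` of dimensions `l, m, n`, if `T' : Hᵃ(Z(ℂ)) → H^{a₁}(Y(ℂ))` and
`T : H^{a₁}(Y(ℂ)) → H^{a₂}(X(ℂ))` are induced by algebraic classes, so is `T ∘ T'` (degree proviso `a ≤ a₂ + 2n`, automatic for
`a ≤ 2 dim Z`). Proof: normalise both to the complex orientations (§1) and compose the classes (`corrAction_comp`:
`γ'' = c • p₁₃_*(p₁₂^*γ ∪ p₂₃^*γ')`, algebraic by Gysin base change and Voisin II Prop. 9.20).
[cite: Fulton1998, §16.1 Def. 16.1.1 and Prop. 16.1.1] [cite: VoisinHodgeII2003, §9.2.4 Prop. 9.20 and Prop. 9.21]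
[cite: Andre1996Motifs, §2.1 (p. 14)] -/
theorem IsAlgebraicCorrespondence.comp (hX : IsSmoothProjective l X) (hY : IsSmoothProjective m Y)
    (hZ : IsSmoothProjective n Z) {a a₁ a₂ : ℕ} {T' : complexBetti Z a →ₗ[ℂ] complexBetti Y a₁}
    {T : complexBetti Y a₁ →ₗ[ℂ] complexBetti X a₂} (hT' : IsAlgebraicCorrespondence m n Y Z T')
    (hT : IsAlgebraicCorrespondence l m X Y T) (ha : a ≤ a₂ + 2 * n) :
    IsAlgebraicCorrespondence l n X Z (T ∘ₗ T') := by
  have hb := IsAlgebraicCorrespondence.le_two_mul hT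
  obtain ⟨e', h₁, γ', hγ', rfl⟩ := IsAlgebraicCorrespondence.exists_eq_corrAction hY hZ hT'
  obtain ⟨e, h₂, γ, hγ, rfl⟩ := IsAlgebraicCorrespondence.exists_eq_corrAction hX hY hT
  obtain ⟨e'', he⟩ : ∃ e'' : ℕ, e + e' = e'' + m := ⟨e + e' - m, by omega⟩
  obtain ⟨γ'', hγ'', h''⟩ := corrAction_comp complexOrientationFamily hX hY hZ he h₁ h₂
    (show a + 2 * e'' = a₂ + 2 * n by omega) hγ hγ'
  rw [← h'']
  exact isAlgebraicCorrespondence_corrAction_complex hX hZ _ hb hγ''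

/-- **Precomposition with a Lefschetz power of an algebraic class keeps a correspondence algebraic**:
`T ∘ Lʳ_η` for `η ∈ N¹ H²(X(ℂ))` (`corrAction_comp_lefschetzPow`: the class is `pr_X^* ηʳ ∪ γ`).
[cite: VoisinHodgeII2003, §9.2.4 Prop. 9.20 and proof of Thm. 10.17 (10.7)] -/
theorem IsAlgebraicCorrespondence.comp_lefschetzPow (hW : IsSmoothProjective m W) (hX : IsSmoothProjective n X)
    {η : complexBetti X 2} (hη : η ∈ algebraicClasses X 1) (a r : ℕ) {b : ℕ}
    {T : complexBetti X (a + 2 * r) →ₗ[ℂ] complexBetti W b} (hT : IsAlgebraicCorrespondence m n W X T) :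
    IsAlgebraicCorrespondence m n W X (T ∘ₗ lefschetzPow η r a) := by
  have hb := IsAlgebraicCorrespondence.le_two_mul hT
  obtain ⟨e, hab, γ, hγ, rfl⟩ := IsAlgebraicCorrespondence.exists_eq_corrAction hW hX hT
  obtain ⟨γ', hγ', h'⟩ := corrAction_comp_lefschetzPow complexOrientationFamily hW hX hη a r (e := e) (e' := e + r) rfl
    hab (show a + 2 * (e + r) = b + 2 * n by omega) hγ
  have heq : corrAction complexOrientationFamily hW hX hab γ ∘ₗ lefschetzPow η r a =
      corrAction complexOrientationFamily hW hX (show a + 2 * (e + r) = b + 2 * n by omega) γ' :=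
    LinearMap.ext fun x ↦ by rw [LinearMap.comp_apply, h' x]
  rw [heq]
  exact isAlgebraicCorrespondence_corrAction_complex hW hX _ hb hγ'

/-! ## §3 Sums and scalars -/

/-- **The zero map is an algebraic correspondence** (class `0`), in every pair of degrees admitting a codimension
(`a + 2e = b + 2 dim X`, `b ≤ 2 dim W`). [cite: Andre1996Motifs, §2.1 (p. 14)] -/
theorem isAlgebraicCorrespondence_zero (hW : IsSmoothProjective m W) (hX : IsSmoothProjective n X) {e a b : ℕ}
    (hab : a + 2 * e = b + 2 * n) (hb : b ≤ 2 * m) :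
    IsAlgebraicCorrespondence m n W X (0 : complexBetti X a →ₗ[ℂ] complexBetti W b) := by
  have h := isAlgebraicCorrespondence_corrAction_complex hW hX hab hb (Submodule.zero_mem (algebraicClasses (W ⊗ X) e))
  rwa [map_zero] at h

/-- **Scalar multiples of algebraic correspondences are algebraic correspondences** (`algebraicClasses` is a `ℂ`-subspace).
[cite: Andre1996Motifs, §2.1 (p. 14)] -/
theorem IsAlgebraicCorrespondence.smul (hW : IsSmoothProjective m W) (hX : IsSmoothProjective n X) {a b : ℕ}
    {T : complexBetti X a →ₗ[ℂ] complexBetti W b} (hT : IsAlgebraicCorrespondence m n W X T) (c : ℂ) :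
    IsAlgebraicCorrespondence m n W X (c • T) := by
  have hb := IsAlgebraicCorrespondence.le_two_mul hT
  obtain ⟨e, hab, γ, hγ, rfl⟩ := IsAlgebraicCorrespondence.exists_eq_corrAction hW hX hT
  rw [← map_smul]
  exact isAlgebraicCorrespondence_corrAction_complex hW hX hab hb (Submodule.smul_mem _ _ hγ)

/-- **Sums of algebraic correspondences (same degrees) are algebraic correspondences.** The two codimensions agree
(`a + 2e = b + 2n` determines `e`), and `corrAction` is additive in the class. [cite: Andre1996Motifs, §2.1 (p. 14)] -/
theorem IsAlgebraicCorrespondence.add (hW : IsSmoothProjective m W) (hX : IsSmoothProjective n X) {a b : ℕ}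
    {T₁ T₂ : complexBetti X a →ₗ[ℂ] complexBetti W b} (h₁ : IsAlgebraicCorrespondence m n W X T₁)
    (h₂ : IsAlgebraicCorrespondence m n W X T₂) : IsAlgebraicCorrespondence m n W X (T₁ + T₂) := by
  have hb := IsAlgebraicCorrespondence.le_two_mul h₁
  obtain ⟨e₁, hab₁, γ₁, hγ₁, rfl⟩ := IsAlgebraicCorrespondence.exists_eq_corrAction hW hX h₁
  obtain ⟨e₂, hab₂, γ₂, hγ₂, rfl⟩ := IsAlgebraicCorrespondence.exists_eq_corrAction hW hX h₂
  obtain rfl : e₁ = e₂ := by omega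
  rw [← map_add]
  exact isAlgebraicCorrespondence_corrAction_complex hW hX hab₁ hb (Submodule.add_mem _ hγ₁ hγ₂)

/-- Negatives of algebraic correspondences are algebraic correspondences. [cite: Andre1996Motifs, §2.1 (p. 14)] -/
theorem IsAlgebraicCorrespondence.neg (hW : IsSmoothProjective m W) (hX : IsSmoothProjective n X) {a b : ℕ}
    {T : complexBetti X a →ₗ[ℂ] complexBetti W b} (hT : IsAlgebraicCorrespondence m n W X T) :
    IsAlgebraicCorrespondence m n W X (-T) := by
  have h := IsAlgebraicCorrespondence.smul hW hX hT (-1)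
  rwa [neg_one_smul] at h

/-- Differences of algebraic correspondences are algebraic correspondences. [cite: Andre1996Motifs, §2.1 (p. 14)] -/
theorem IsAlgebraicCorrespondence.sub (hW : IsSmoothProjective m W) (hX : IsSmoothProjective n X) {a b : ℕ}
    {T₁ T₂ : complexBetti X a →ₗ[ℂ] complexBetti W b} (h₁ : IsAlgebraicCorrespondence m n W X T₁)
    (h₂ : IsAlgebraicCorrespondence m n W X T₂) : IsAlgebraicCorrespondence m n W X (T₁ - T₂) := by
  rw [sub_eq_add_neg]
  exact IsAlgebraicCorrespondence.add hW hX h₁ (IsAlgebraicCorrespondence.neg hW hX h₂)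

/-- **Finite linear combinations of algebraic correspondences are algebraic correspondences** (non-empty index set, or
degrees admitting a codimension — here: a non-empty family, so that the codimension is read off a member).
[cite: Andre1996Motifs, §2.1 (p. 14)] [cite: Kleiman1968AlgebraicCycles, §1.3] -/
theorem IsAlgebraicCorrespondence.sum (hW : IsSmoothProjective m W) (hX : IsSmoothProjective n X) {a b : ℕ}
    {ι : Type*} (s : Finset ι) (d : ι → ℂ) (T : ι → (complexBetti X a →ₗ[ℂ] complexBetti W b))
    (hT : ∀ k, IsAlgebraicCorrespondence m n W X (T k)) (k₀ : ι) :
    IsAlgebraicCorrespondence m n W X (∑ k ∈ s, d k • T k) := by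
  classical
  have hb := IsAlgebraicCorrespondence.le_two_mul (hT k₀)
  obtain ⟨e, hab, -, -, -⟩ := IsAlgebraicCorrespondence.exists_eq_corrAction hW hX (hT k₀)
  induction s using Finset.induction_on with
  | empty =>
    rw [Finset.sum_empty]
    exact isAlgebraicCorrespondence_zero hW hX hab hb
  | insert k s hk ih =>
    rw [Finset.sum_insert hk]
    exact IsAlgebraicCorrespondence.add hW hX (IsAlgebraicCorrespondence.smul hW hX (hT k) (d k)) ih

end Part2

end Literature.AlgebraicGeometry.HodgeTheory.AlgebraicCorrespondence

end
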